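import Mathlib
import Literature.Geometry.Lorentzian.KerrConvergence
import Literature.Geometry.Lorentzian.KerrSchild
import HarnessLib

/-!
# Anchored paths in the radial band of a boosted Kerr background

Topic `Literature/Geometry/Lorentzian`. The named fact `BandAnchoredPaths` — on a boosted Kerr–Schild
background (`boostedKerrBackground Λ c M a`, `KerrSchild.lean` / `KerrConvergence.lean`) with
orthochronous boost `Λ` and a monotone wall `W`, every point of the band
`{τ₁ ≤ t, R₁ + ½ ≤ r ≤ W(x⁰)}` lies on a preconnected coordinate set inside the band meeting the anchor
sphere `{r = R₁ + ½}` (elementary connectedness of the band in Kerr–Schild coordinates; step S3a of the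
neck-gap decay argument of the `FinalStateConjecture/StarvedNecks` line).

Provenance: the gate parked this `[folklore]` proposition, written inline in the Summits proposal
`Summits/FinalStateConjecture/FinalStateConjecture/Theorems/StarvedNecksNeckGapDecayStubBandAnchoredPaths.lean`,
at `Literature/Uncategorized/BandAnchoredPaths.lean` (human ruling 2026-08-15); moved here by the
librarian (statement byte-identical; the old module keeps a deprecated reducible `abbrev`). Its objects
(`boostedKerrBackground`, `KerrSchildBackground.domain/time/radius`, `Kerr.rPlus`) all live in this
directory, hence the home. Discharged below (`BandAnchoredPaths_holds`, the argument of the summit-side stub made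
self-contained: star-shapedness of the confocal ellipsoids `{r < c}` + intermediate value theorem).
-/

namespace Literature.Geometry.Lorentzian

open scoped Manifold ContDiff Topology ENNReal
open Filter Set MeasureTheory Topology

/-- **S3a — anchored paths in the band**: on a boosted Kerr background with orthochronous `Λ` and a monotone
wall `W`, every point of the band `{τ₁ ≤ t, R₁+½ ≤ r ≤ W(x⁰)}` (`R₁+½` above the domain's inner radius) lies on a
preconnected coordinate set inside the band that meets the anchor sphere `{r = R₁+½}`. [folklore] -/
def BandAnchoredPaths : Prop :=
  ∀ (Λ : lorentzGroup) (c : E4) (M a : ℝ) (W : ℝ → ℝ) (R₁ τ₁ : ℝ),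
    0 < (Λ : E4 ≃L[ℝ] E4) (E4.basisVector 0) 0 → Monotone W → max (Kerr.rPlus M a) 0 < R₁ + 1 / 2 →
    let B := boostedKerrBackground Λ c M a
    ∀ x : B.domain, τ₁ ≤ B.time x.1 → R₁ + 1 / 2 ≤ B.radius x.1 → B.radius x.1 ≤ W (x.1 0) →
      ∃ S : Set E4, IsPreconnected S ∧ S ⊆ (B.domain : Set E4) ∧ x.1 ∈ S ∧
        (∀ z ∈ S, τ₁ ≤ B.time z ∧ R₁ + 1 / 2 ≤ B.radius z ∧ B.radius z ≤ W (z 0)) ∧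
        ∃ y ∈ S, B.radius y = R₁ + 1 / 2


/-- **`BandAnchoredPaths` holds** (discharge of the named fact; the argument of the summit-side stub
`stub_bandAnchoredPaths`, made self-contained): every band point is joined inside the band to the anchor sphere
`{r = R₁+½}` by the boosted image of the rest-frame path `σ ↦ (τ + (1 − σ) s₀, σ ξ)`, `σ ∈ [σ⋆, 1]` — forward in
rest-frame time, inward along the spatial ray through `ξ`, on which the Kerr–Schild radius is monotone (the solid
confocal ellipsoids `{r < c}` are star-shaped: `r < c ↔ c²(x₁² + x₂²) + (c² + a²)x₃² < c²(c² + a²)`, from the quartic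
`r⁴ − (‖x⃗‖² − a²) r² − a² x₃² = 0`), cut at `r = R₁ + ½` by the intermediate value theorem (`r(τ, 0) = 0`), with `s₀`
chosen so that lab time does not decrease along the path (the wall `W` is monotone). O'Neill 1995, Ch. 2 §2.1;
Visser arXiv:0706.0622, (35). [folklore] -/
theorem BandAnchoredPaths_holds : BandAnchoredPaths := by
  -- (1) `{r < c}` is the open solid confocal ellipsoid (`c > 0`)
  have sublevel : ∀ (a : ℝ) {c : ℝ}, 0 < c → ∀ x : E4,
      Kerr.radius a x < c ↔ c ^ 2 * (x 1 ^ 2 + x 2 ^ 2) + (c ^ 2 + a ^ 2) * x 3 ^ 2 < c ^ 2 * (c ^ 2 + a ^ 2) := by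
    intro a c hc x
    have hr := Kerr.radius_nonneg a x
    have hkey : c ^ 2 * (c ^ 2 + a ^ 2) - (c ^ 2 * (x 1 ^ 2 + x 2 ^ 2) + (c ^ 2 + a ^ 2) * x 3 ^ 2) =
        (c ^ 2 - Kerr.radius a x ^ 2) * (c ^ 2 + Kerr.radius a x ^ 2 - (E4.spatialNorm x ^ 2 - a ^ 2)) := by
      linear_combination Kerr.radius_quartic a x + c ^ 2 * E4.spatialNorm_sq x
    have hle : E4.spatialNorm x ^ 2 - a ^ 2 ≤ Kerr.radius a x ^ 2 := by
      rw [Kerr.radius_sq]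
      have h1 : |E4.spatialNorm x ^ 2 - a ^ 2| ≤ √((E4.spatialNorm x ^ 2 - a ^ 2) ^ 2 + 4 * a ^ 2 * x 3 ^ 2) :=
        Real.abs_le_sqrt (by nlinarith [sq_nonneg (a * x 3)])
      linarith [le_abs_self (E4.spatialNorm x ^ 2 - a ^ 2)]
    have hpos : 0 < c ^ 2 + Kerr.radius a x ^ 2 - (E4.spatialNorm x ^ 2 - a ^ 2) := by nlinarith
    constructor
    · intro h
      have h1 : 0 < c ^ 2 - Kerr.radius a x ^ 2 := by nlinarith
      have h2 := mul_pos h1 hpos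
      linarith [hkey]
    · intro h
      have h1 : 0 < (c ^ 2 - Kerr.radius a x ^ 2) *
          (c ^ 2 + Kerr.radius a x ^ 2 - (E4.spatialNorm x ^ 2 - a ^ 2)) := by linarith [hkey]
      have h2 : 0 < c ^ 2 - Kerr.radius a x ^ 2 := (pos_iff_pos_of_mul_pos h1).2 hpos
      nlinarith
  -- (2) components of a ray point `(τ, s v)`
  have ray_apply : ∀ (τ s : ℝ) (v : E3),
      E4.ofTimeSpace τ (s • v) 1 = s * v 0 ∧ E4.ofTimeSpace τ (s • v) 2 = s * v 1 ∧
        E4.ofTimeSpace τ (s • v) 3 = s * v 2 := by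
    intro τ s v
    refine ⟨?_, ?_, ?_⟩
    · have h := E4.ofTimeSpace_apply_succ τ (s • v) 0
      simpa using h
    · have h := E4.ofTimeSpace_apply_succ τ (s • v) 1
      simpa using h
    · have h := E4.ofTimeSpace_apply_succ τ (s • v) 2
      simpa using h
  -- (3) ray monotonicity of the Kerr–Schild radius
  have radius_ray_monotone : ∀ (a τ : ℝ) (v : E3) {s s' : ℝ}, 0 ≤ s → s ≤ s' →
      Kerr.radius a (E4.ofTimeSpace τ (s • v)) ≤ Kerr.radius a (E4.ofTimeSpace τ (s' • v)) := by
    intro a τ v s s' hs hss'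
    by_contra hlt
    push Not at hlt
    obtain ⟨hy1, hy2, hy3⟩ := ray_apply τ s v
    obtain ⟨hy'1, hy'2, hy'3⟩ := ray_apply τ s' v
    set y := E4.ofTimeSpace τ (s • v) with hy
    set y' := E4.ofTimeSpace τ (s' • v) with hy'
    set c := Kerr.radius a y with hcdef
    have hc : 0 < c := (Kerr.radius_nonneg a y').trans_lt hlt
    have h1 := (sublevel a hc y').1 hlt
    have h2 : ¬ (Kerr.radius a y < c) := lt_irrefl _
    rw [sublevel a hc y] at h2
    push Not at h2
    rw [hy1, hy2, hy3] at h2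
    rw [hy'1, hy'2, hy'3] at h1
    have hQ : 0 ≤ c ^ 2 * (v 0 ^ 2 + v 1 ^ 2) + (c ^ 2 + a ^ 2) * v 2 ^ 2 := by positivity
    have hs2 : s ^ 2 ≤ s' ^ 2 := pow_le_pow_left₀ hs hss' 2
    have key : c ^ 2 * ((s * v 0) ^ 2 + (s * v 1) ^ 2) + (c ^ 2 + a ^ 2) * (s * v 2) ^ 2 ≤
        c ^ 2 * ((s' * v 0) ^ 2 + (s' * v 1) ^ 2) + (c ^ 2 + a ^ 2) * (s' * v 2) ^ 2 := by
      have := mul_le_mul_of_nonneg_right hs2 hQ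
      nlinarith [this]
    linarith
  -- (4) `r(τ, 0) = 0`
  have radius_ofTimeSpace_zero_right : ∀ a τ : ℝ, Kerr.radius a (E4.ofTimeSpace τ 0) = 0 := by
    intro a τ
    have h3 : E4.ofTimeSpace τ (0 : E3) 3 = 0 := by
      have h := E4.ofTimeSpace_apply_succ τ (0 : E3) 2
      simpa using h
    have hsq := Kerr.radius_sq a (E4.ofTimeSpace τ 0)
    rw [E4.spatialNorm_ofTimeSpace, norm_zero, h3] at hsq
    have hd : √((0 ^ 2 - a ^ 2) ^ 2 + 4 * a ^ 2 * 0 ^ 2 : ℝ) = a ^ 2 := by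
      rw [show ((0 : ℝ) ^ 2 - a ^ 2) ^ 2 + 4 * a ^ 2 * 0 ^ 2 = (a ^ 2) ^ 2 by ring]
      exact Real.sqrt_sq (sq_nonneg a)
    rw [hd] at hsq
    have h0 : Kerr.radius a (E4.ofTimeSpace τ 0) ^ 2 = 0 := by rw [hsq]; ring
    exact pow_eq_zero_iff (two_ne_zero) |>.mp h0
  -- (5) `(t, y) = t e₀ + (0, y)` and `(0, σ y) = σ (0, y)`; the radius does not see the time
  have ofTimeSpace_eq_smul_add : ∀ (t : ℝ) (y : E3),
      E4.ofTimeSpace t y = t • E4.basisVector 0 + E4.ofTimeSpace 0 y := by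
    intro t y
    ext i
    refine Fin.cases ?_ (fun j => ?_) i
    · simp
    · simp [Fin.succ_ne_zero]
  have ofTimeSpace_zero_smul : ∀ (σ : ℝ) (y : E3), E4.ofTimeSpace 0 (σ • y) = σ • E4.ofTimeSpace 0 y := by
    intro σ y
    ext i
    refine Fin.cases ?_ (fun j => ?_) i
    · simp
    · simp
  have radius_ofTimeSpace_time : ∀ (a t t' : ℝ) (y : E3),
      Kerr.radius a (E4.ofTimeSpace t y) = Kerr.radius a (E4.ofTimeSpace t' y) := by
    intro a t t' y
    have h3 : E4.ofTimeSpace t y 3 = y 2 := by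
      have h := E4.ofTimeSpace_apply_succ t y 2
      simpa using h
    have h3' : E4.ofTimeSpace t' y 3 = y 2 := by
      have h := E4.ofTimeSpace_apply_succ t' y 2
      simpa using h
    unfold Kerr.radius
    rw [E4.spatialNorm_ofTimeSpace, E4.spatialNorm_ofTimeSpace, h3, h3']
  -- (6) the argument
  intro Λ c M a W R₁ τ₁ hv hW hR B x hxt hxr hxW
  set L : E4 ≃L[ℝ] E4 := (Λ : E4 ≃L[ℝ] E4) with hLdef
  set e₀ : E4 := E4.basisVector 0 with he₀
  set v0 : ℝ := L e₀ 0 with hv0def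
  have hv0 : 0 < v0 := hv
  set x' : E4 := poincareInv Λ c x.1 with hx'def
  set τ : ℝ := x' 0 with hτdef
  set ξ : E3 := E4.spatial x' with hξdef
  have hx' : x' = E4.ofTimeSpace τ ξ := (E4.ofTimeSpace_time_spatial x').symm
  set ζ : E4 := E4.ofTimeSpace 0 ξ with hζdef
  set ℓ : ℝ := L ζ 0 with hℓdef
  set s₀ : ℝ := |ℓ| / v0 with hs₀def
  have hs₀ : 0 ≤ s₀ := div_nonneg (abs_nonneg _) hv0.le
  have hs₀v : s₀ * v0 = |ℓ| := div_mul_cancel₀ _ hv0.ne'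
  have hxt' : τ₁ ≤ τ := hxt
  have hxr' : R₁ + 1 / 2 ≤ Kerr.radius a x' := hxr
  have hxW' : Kerr.radius a x' ≤ W (x.1 0) := hxW
  let p : ℝ → E4 := fun σ ↦ (τ + (1 - σ) * s₀) • e₀ + σ • ζ
  let γ : ℝ → E4 := fun σ ↦ L (p σ) + c
  let f : ℝ → ℝ := fun σ ↦ Kerr.radius a (E4.ofTimeSpace τ (σ • ξ))
  have hp : ∀ σ, p σ = E4.ofTimeSpace (τ + (1 - σ) * s₀) (σ • ξ) := by
    intro σ
    rw [ofTimeSpace_eq_smul_add, ofTimeSpace_zero_smul]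
  have hγinv : ∀ σ, poincareInv Λ c (γ σ) = p σ := by
    intro σ
    simp only [γ, poincareInv, add_sub_cancel_right, hLdef, ContinuousLinearEquiv.symm_apply_apply]
  have hp1 : p 1 = x' := by
    rw [hp, hx', sub_self, zero_mul, add_zero, one_smul]
  have hγ1 : γ 1 = x.1 := by
    have h : L (poincareInv Λ c x.1) + c = x.1 := by
      simp only [poincareInv, hLdef, ContinuousLinearEquiv.apply_symm_apply, sub_add_cancel]
    show L (p 1) + c = x.1
    rw [hp1]
    exact h
  have hpc : Continuous p := by
    show Continuous fun σ : ℝ ↦ (τ + (1 - σ) * s₀) • e₀ + σ • ζ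
    fun_prop
  have hγc : Continuous γ := (L.continuous.comp hpc).add continuous_const
  have hfc : Continuous f :=
    (Kerr.continuous_radius a).comp
      ((E4.continuous_ofTimeSpace τ).comp (continuous_id.smul continuous_const))
  have hf0 : f 0 = 0 := by
    show Kerr.radius a (E4.ofTimeSpace τ ((0 : ℝ) • ξ)) = 0
    rw [zero_smul]
    exact radius_ofTimeSpace_zero_right a τ
  have hf1 : f 1 = Kerr.radius a x' := by
    show Kerr.radius a (E4.ofTimeSpace τ ((1 : ℝ) • ξ)) = _
    rw [one_smul, hx']
  have htime : ∀ σ, poincareInv Λ c (γ σ) 0 = τ + (1 - σ) * s₀ := by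
    intro σ
    rw [hγinv, hp]
    exact E4.ofTimeSpace_apply_zero _ _
  have hrad : ∀ σ, Kerr.radius a (poincareInv Λ c (γ σ)) = f σ := by
    intro σ
    rw [hγinv, hp]
    exact radius_ofTimeSpace_time a _ τ _
  have hlab : ∀ σ, γ σ 0 = (τ + (1 - σ) * s₀) * v0 + σ * ℓ + c 0 := by
    intro σ
    show (L ((τ + (1 - σ) * s₀) • e₀ + σ • ζ) + c) 0 = _
    rw [map_add, map_smul, map_smul]
    rfl
  have hx0 : x.1 0 = τ * v0 + ℓ + c 0 := by
    have h := hlab 1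
    rw [hγ1] at h
    rw [h]
    ring
  have hlab_ge : ∀ σ, σ ≤ 1 → x.1 0 ≤ γ σ 0 := by
    intro σ hσ
    rw [hlab, hx0]
    have h1 : 0 ≤ 1 - σ := sub_nonneg.mpr hσ
    have h2 : ℓ ≤ |ℓ| := le_abs_self ℓ
    nlinarith [mul_nonneg h1 (sub_nonneg.mpr h2)]
  have hRpos : 0 < R₁ + 1 / 2 := (le_max_right _ _).trans_lt hR
  obtain ⟨σ₀, hσ₀, hfσ₀⟩ : ∃ σ₀ ∈ Icc (0 : ℝ) 1, f σ₀ = R₁ + 1 / 2 :=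
    intermediate_value_Icc zero_le_one hfc.continuousOn
      ⟨by rw [hf0]; exact hRpos.le, by rw [hf1]; exact hxr'⟩
  have hseg : ∀ σ ∈ Icc σ₀ 1, R₁ + 1 / 2 ≤ f σ ∧ f σ ≤ Kerr.radius a x' := by
    intro σ hσ
    have hlo : f σ₀ ≤ f σ := radius_ray_monotone a τ ξ hσ₀.1 hσ.1
    have hhi : f σ ≤ f 1 := radius_ray_monotone a τ ξ (hσ₀.1.trans hσ.1) hσ.2
    rw [hfσ₀] at hlo
    rw [hf1] at hhi
    exact ⟨hlo, hhi⟩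
  refine ⟨γ '' Icc σ₀ 1, isPreconnected_Icc.image γ hγc.continuousOn, ?_, ⟨1, right_mem_Icc.mpr hσ₀.2, hγ1⟩,
    ?_, ⟨γ σ₀, ⟨σ₀, left_mem_Icc.mpr hσ₀.2, rfl⟩, ?_⟩⟩
  · rintro _ ⟨σ, hσ, rfl⟩
    show poincareInv Λ c (γ σ) ∈ Kerr.exterior M a
    rw [Kerr.mem_exterior, hrad]
    exact hR.trans_le (hseg σ hσ).1
  · rintro _ ⟨σ, hσ, rfl⟩
    refine ⟨?_, ?_, ?_⟩
    · show τ₁ ≤ poincareInv Λ c (γ σ) 0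
      rw [htime]
      have : 0 ≤ (1 - σ) * s₀ := mul_nonneg (sub_nonneg.mpr hσ.2) hs₀
      linarith
    · show R₁ + 1 / 2 ≤ Kerr.radius a (poincareInv Λ c (γ σ))
      rw [hrad]
      exact (hseg σ hσ).1
    · show Kerr.radius a (poincareInv Λ c (γ σ)) ≤ W (γ σ 0)
      rw [hrad]
      exact ((hseg σ hσ).2.trans hxW').trans (hW (hlab_ge σ hσ.2))
  · show Kerr.radius a (poincareInv Λ c (γ σ₀)) = R₁ + 1 / 2
    rw [hrad]
    exact hfσ₀

end Literature.Geometry.Lorentzian
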